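import Literature.MathematicalPhysics.QuantumLattice.KagomeLattice
import HarnessLib

/-!
# The kagome lattice is `4`-regular (discharge of `degree_kagomeGraph`)

Sibling proof file of `KagomeLattice.lean` (next to `KagomeLatticeProofs.lean`,
`KagomeLatticeRot60Proofs.lean`). No statement is introduced or changed; this file
**discharges the named fact** `degree_kagomeGraph` (`degree_kagomeGraph_holds`): every vertex of
the kagome lattice `kagomeGraph` has exactly `4` neighbours (Savary–Balents, *Quantum spin
liquids: a review*, Rep. Prog. Phys. **80** (2017) 016502, §6.4.2 "Kagomé models" — the
nearest-neighbour bonds of the kagomé lattice — and §7.1.1, "kagomé (corner-sharing triangles)":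
each site is the corner shared by one up and one down triangle, whence coordination number `4`).

## The proof

* `degree_kagomeGraph_shift`: the translation `KagomeVertex.shift v` is a graph automorphism
  (`kagomeGraph_adj_shift_iff`, proved in `KagomeLattice.lean`), so Mathlib's
  `SimpleGraph.Iso.mapNeighborSet` gives a bijection of neighbour sets and the degree of `(x, s)`
  equals the degree of `(0, s)`.
* For the three sites `(0, s)`, `s : Fin 3`, of the cell `0` the degree is a closed finite
  computation: the `LocallyFinite` instance of `KagomeLattice.lean` enumerates the neighbours
  inside the `7 × 3` candidates `kagomeNeighborCells 0 ×ˢ univ` by the decidable adjacency table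
  `KagomeAdjRel ℤ`, and `decide` (kernel evaluation) returns `4` in each case; explicitly the
  neighbours are `(0, 0) ∼ (0, 1), (0, 2), (-e₁, 2), (e₀ - e₁, 1)`;
  `(0, 1) ∼ (0, 0), (0, 2), (-e₀, 2), (e₁ - e₀, 0)`; `(0, 2) ∼ (0, 0), (0, 1), (e₀, 1), (e₁, 0)`
  (two in the up triangle of the cell, two in the down triangle through the site).

## References

* [SavaryBalents2017] L. Savary, L. Balents, *Quantum spin liquids: a review*, Rep. Prog. Phys.
  **80** (2017) 016502, doi:10.1088/0034-4885/80/1/016502, arXiv:1601.03742, §6.4.2, §7.1.1.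
-/

namespace Literature.MathematicalPhysics.QuantumLattice

open Literature.Probability.LatticeModels

/-- Translations preserve degrees in the kagome lattice: `KagomeVertex.shift v` is a graph
automorphism (`kagomeGraph_adj_shift_iff`), hence restricts to a bijection between neighbour sets.
(Savary–Balents 2017, §6.4.2 (kagomé models) and §7.1.1 (the kagomé lattice of corner-sharing
triangles); translation invariance of the lattice.) [cite: SavaryBalents2017, §6.4.2 and §7.1.1] -/
theorem degree_kagomeGraph_shift (v : Site 2) (a : KagomeVertex) :
    kagomeGraph.degree (KagomeVertex.shift v a) = kagomeGraph.degree a := by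
  let φ : kagomeGraph ≃g kagomeGraph := ⟨KagomeVertex.shift v, kagomeGraph_adj_shift_iff v _ _⟩
  rw [← SimpleGraph.card_neighborSet_eq_degree, ← SimpleGraph.card_neighborSet_eq_degree]
  exact (Fintype.card_congr (φ.mapNeighborSet a)).symm

/-- Every kagome site has exactly `4` neighbours (discharge of `degree_kagomeGraph`): by
translation invariance (`degree_kagomeGraph_shift`) it suffices to treat the three sites `(0, s)`
of the cell `0`, whose neighbours are read off the finite adjacency table — `(0, 0)`:
`(0, 1), (0, 2), (-e₁, 2), (e₀ - e₁, 1)`; `(0, 1)`: `(0, 0), (0, 2), (-e₀, 2), (e₁ - e₀, 0)`;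
`(0, 2)`: `(0, 0), (0, 1), (e₀, 1), (e₁, 0)` (two in the up triangle, two in the down triangle).
(Savary–Balents 2017, §6.4.2 (kagomé models, nearest-neighbour bonds) and §7.1.1 ("kagomé
(corner-sharing triangles)"): each site is the corner shared by one up and one down triangle, so
its coordination number is `4`.) [cite: SavaryBalents2017, §6.4.2 and §7.1.1] -/
theorem degree_kagomeGraph_holds : degree_kagomeGraph := by
  rintro ⟨x, s⟩
  have h0 : KagomeVertex.shift x ((0 : Site 2), s) = (x, s) := by simp
  have h := degree_kagomeGraph_shift x (0, s)
  rw [h0] at h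
  rw [h]
  fin_cases s <;> decide +kernel

end Literature.MathematicalPhysics.QuantumLattice
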